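import Mathlib
import Summits.CriticalPhenomena.SAWScalingLimit.Theses.SAWRenewalTightness
import Literature.Probability.RandomPlanarGeometry.SAWRenewalBound

/-!
# Sketch — crux-ideate stmt-CriticalPhenomena-4729 (AnnularMassDecay), ideator 1, round 1

First-lemma signatures for the three idea cards (not proved here; they must only elaborate):

* card `kesten-bridge-reference-measure`: `HalfPlaneContainment`, `MonotoneAnnularMassLeOne`;
* card `radial-renewal-kesten-inequality`: `RadialKestenInequality`, `AnnularMassBounded`,
  `RKI_implies_bounded`;
* card `quarter-turn-kesten-sink`: `NWalkIrreducible`, `KraftAtCritical`.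
-/

namespace Summit.CriticalPhenomena.SAWScalingLimit.Cruxes.AnnularMassDecay.Ideator1

open scoped BigOperators Classical
open Literature.Probability.LatticeModels Literature.Probability.RandomPlanarGeometry

noncomputable section

/-- Geometry behind card A: the open disc `D_R(z)` lies in the open half-plane through `u`
orthogonal to `z - u` whenever `R ≤ |u - z|`; hence every annular bridge from `u` is a
half-plane walk for the linear functional `v ↦ Re((v-u)·conj(z-u))` (direction `e_u`). -/
def HalfPlaneContainment : Prop :=
  ∀ (z u v : ℂ) (R : ℝ), 0 < R → R ≤ dist u z → dist v z < R →
    0 < ((v - u) * (starRingEnd ℂ) (z - u)).re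

/-- Card A, first lemma (the renewal-point part of the exact decomposition, pole case):
for a lattice start `u` and centre `z = u + R` (so that `u` is the west pole of `D_R(z)`), the
`x_c`-mass of annular bridges whose endpoint is a strict first-coordinate record ("monotone class":
the endpoint is a Kesten renewal point) is at most `1`, uniformly in `r, R, N` — a prefix-free family
of bridges weighs at most `Σ_irr x_c^{|β|} ≤ 1` (Kraft inequality over Kesten's sub-stochastic
irreducible-bridge kernel). -/
def MonotoneAnnularMassLeOne : Prop :=
  ∀ (u : Site 2) (r R : ℝ), 1 ≤ r → r < R → ∀ N : ℕ,
    (∑ n ∈ Finset.range (N + 1), ∑ _ω ∈ (SAW.Zd.saws 2 n).filter (fun ω =>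
        (∀ i, 0 < i → i < n →
            r < dist (Site.toComplex (u + ω i)) (Site.toComplex u + R) ∧
              dist (Site.toComplex (u + ω i)) (Site.toComplex u + R) < R) ∧
          dist (Site.toComplex (u + ω n)) (Site.toComplex u + R) ≤ r ∧
          (∀ i, i < n → (u + ω i) 0 < (u + ω n) 0)),
      SAW.criticalFugacity ^ n) ≤ 1

/-- Card B, the **radial Kesten inequality** (RKI): from any start `u` outside the open disc
`D_R(z)`, the `x_c`-mass of *radially irreducible descents* — walks entering `D_R(z)`, staying in it,
ending at a strict radial record (closest point to `z` so far) and having no intermediate radial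
renewal time (a time `t` whose circle about `z` separates the past, strictly outside, from the
future, strictly inside) — is at most `1`. The linear analogue is Kesten's `Σ_irr x_c^{|β|} = 1`. -/
def RadialKestenInequality : Prop :=
  ∀ (z : ℂ) (R : ℝ), 0 < R → ∀ (u : Site 2), R ≤ dist (Site.toComplex u) z → ∀ N : ℕ,
    (∑ n ∈ Finset.range (N + 1), ∑ _ω ∈ (SAW.Zd.saws 2 n).filter (fun ω =>
        0 < n ∧
        (∀ i, 0 < i → i ≤ n → dist (Site.toComplex (u + ω i)) z < R) ∧
        (∀ i, i < n → dist (Site.toComplex (u + ω n)) z < dist (Site.toComplex (u + ω i)) z) ∧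
        (∀ t, 0 < t → t < n →
          ¬ ((∀ i, i < t → dist (Site.toComplex (u + ω t)) z < dist (Site.toComplex (u + ω i)) z) ∧
             (∀ j, t < j → j ≤ n →
                dist (Site.toComplex (u + ω j)) z < dist (Site.toComplex (u + ω t)) z)))),
      SAW.criticalFugacity ^ n) ≤ 1

/-- The `θ = 0` content of the crux (uniform boundedness of the annular-bridge mass). -/
def AnnularMassBounded : Prop :=
  ∃ C : ℝ, ∀ (z : ℂ) (r R : ℝ), 1 ≤ r → r < R → ∀ (u : Site 2),
    R ≤ dist (Site.toComplex u) z → ∀ N : ℕ,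
    (∑ n ∈ Finset.range (N + 1), ∑ _ω ∈ (SAW.Zd.saws 2 n).filter (fun ω =>
        (∀ i, 0 < i → i < n → r < dist (Site.toComplex (u + ω i)) z ∧
            dist (Site.toComplex (u + ω i)) z < R) ∧
          dist (Site.toComplex (u + ω n)) z ≤ r),
      SAW.criticalFugacity ^ n) ≤ C

/-- Card B, first lemma: the exact first-radial-renewal recursion turns RKI into the `θ = 0` half
of the crux (induction on the finitely many lattice configurations below scale `R`). -/
def RKI_implies_bounded : Prop := RadialKestenInequality → AnnularMassBounded


/-- Card B, hypothesis (i) of the seed-to-decay recursion: the annular-bridge mass is bounded by a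
constant `< 1` uniformly over centre, scales and start (heuristically the worst case is the trivial
thin annulus: at most two inward neighbours, `2·x_c ≈ 0.758`; exact enumeration up to `R² = 13`
gives `sup_r M = 0.758`). -/
def RadialSeed : Prop :=
  ∃ ε : ℝ, 0 < ε ∧ ∀ (z : ℂ) (r R : ℝ), 0 ≤ r → r < R → ∀ (u : Site 2),
    R ≤ dist (Site.toComplex u) z → ∀ N : ℕ,
    (∑ n ∈ Finset.range (N + 1), ∑ _ω ∈ (SAW.Zd.saws 2 n).filter (fun ω =>
        0 < n ∧
        (∀ i, 0 < i → i < n → r < dist (Site.toComplex (u + ω i)) z ∧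
            dist (Site.toComplex (u + ω i)) z < R) ∧
          dist (Site.toComplex (u + ω n)) z ≤ r),
      SAW.criticalFugacity ^ n) ≤ 1 - ε

/-- Card B, hypothesis (ii) (**skip tail**): walks from `u` into `D_R(z)` whose LAST radial renewal
time `t` lies in the top e-fold (`|ω_t - z| > R/2`) and whose final radially-irreducible piece spans a
ratio `≥ B` (`B·|ω_n - z| ≤ |ω_t - z|`, the end being a strict radial record) have mass
`≤ C·B^{-κ}`: long irreducible radial jumps launched within one e-fold are polynomially rare in the
ratio (linear analogue: the overshoot law of Kesten's renewal process). -/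
def RadialSkipTail : Prop :=
  ∃ κ C : ℝ, 0 < κ ∧ ∀ (B : ℝ), 1 ≤ B → ∀ (z : ℂ) (R : ℝ), 0 < R → ∀ (u : Site 2),
    R ≤ dist (Site.toComplex u) z → ∀ N : ℕ,
    (∑ n ∈ Finset.range (N + 1), ∑ _ω ∈ (SAW.Zd.saws 2 n).filter (fun ω =>
        0 < n ∧
        (∀ i, 0 < i → i ≤ n → dist (Site.toComplex (u + ω i)) z < R) ∧
        (∀ i, i < n → dist (Site.toComplex (u + ω n)) z < dist (Site.toComplex (u + ω i)) z) ∧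
        (∃ t, t < n ∧
          (∀ i, i < t → dist (Site.toComplex (u + ω t)) z < dist (Site.toComplex (u + ω i)) z) ∧
          (∀ j, t < j → j ≤ n → dist (Site.toComplex (u + ω j)) z < dist (Site.toComplex (u + ω t)) z) ∧
          R / 2 < dist (Site.toComplex (u + ω t)) z ∧
          B * dist (Site.toComplex (u + ω n)) z ≤ dist (Site.toComplex (u + ω t)) z ∧
          (∀ s, t < s → s < n →
            ¬ ((∀ i, i < s → dist (Site.toComplex (u + ω s)) z < dist (Site.toComplex (u + ω i)) z) ∧
               (∀ j, s < j → j ≤ n →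
                  dist (Site.toComplex (u + ω j)) z < dist (Site.toComplex (u + ω s)) z))))),
      SAW.criticalFugacity ^ n) ≤ C * B ^ (-κ)

/-- Card B, the composition (Transfer): by the exact first-radial-renewal recursion
`Ψ(xy) ≤ Ψ(x)·Ψ*(y) + Skip`, a renewal-sequence induction turns (RKI, seed, skip tail) into the
crux BY NAME. -/
def RadialSeedToDecay : Prop :=
  RadialKestenInequality → RadialSeed → RadialSkipTail →
    Summit.CriticalPhenomena.SAWScalingLimit.Theses.SAWRenewalTightness.AnnularMassDecay

/-- Card C, first lemma (word model of `SAWWordBridges.lean`): an **N-walk** — a bridge that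
visits its maximal level `xEnd w` at some time `t₁` and the level `1` at a later time `t₂` — has no
break point, i.e. is irreducible; this is the certificate that makes glued "sweep–turn–sweep–turn–
sweep" composites land in Kesten's summable family. -/
def NWalkIrreducible : Prop :=
  ∀ (w : List SAW.Step), SAW.IsBridgeW w →
    (∃ t₁ t₂ : ℕ, t₁ < t₂ ∧ t₂ ≤ w.length ∧ SAW.xAt w t₁ = SAW.xEnd w ∧ SAW.xAt w t₂ = 1) →
      SAW.IsIrreducible w

/-- Card C, the sink: every finite family of irreducible bridges has critical mass at most `1`
(Kraft inequality at `ρ = μ`; from `SAW.Renewal.le_connectiveConstant_of_kraft` by continuity). -/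
def KraftAtCritical : Prop :=
  ∀ S : Finset (List SAW.Step), SAW.Renewal.Admissible S →
    (∑ s ∈ S, SAW.criticalFugacity ^ s.length) ≤ 1

/-- Sanity: the crux decl is in scope (the ideas target it by name). -/
example : Prop := Summit.CriticalPhenomena.SAWScalingLimit.Theses.SAWRenewalTightness.AnnularMassDecay

end

end Summit.CriticalPhenomena.SAWScalingLimit.Cruxes.AnnularMassDecay.Ideator1
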